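import Mathlib
import HarnessLib
import HarnessLib.Audit
import Summits.AtomisticToContinuum.Statement
import Summits.AtomisticToContinuum.FouriersLaw.Theorems.EmbeddedDrudeMourreNessUnique

/-!
Route: GaussianiserCellTransfer

CLOSED (retired) 2026-08-15T13:42:45Z by operator:999:1257524 — reason: not-a-thesis: assembly does not conclude the sub-problem Statement — note: D-0027 §2.1 audit (human 2026-08-15: routes that do not decide the summit are removed): the assembly concludes `Literature.MathematicalPhysics.KineticTheory.HeatConduction.FouriersLaw`, not the sub-problem statement; a NEW conforming route may be opened from the same idea (generated `closes : … → _r. The file is kept as the record of this route; refuted decls are indexed as negative knowledge (`ledger negatives`).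

# Route GaussianiserCellTransfer — dilute conjunct cells in a harmonic host — long segments
Gaussianise, a Perron–Frobenius one-cell transfer gap gives Fourier's law at large spacing;
densification is the plug-in

RUNG-PLUS-PLUG-IN route realising idea card gaussianiser-cell-transfer-gap (spine). MODEL (no new
definition needed; written inline over
FouriersLaw.lean): the d-DILUTE CONJUNCT CHAIN C_d(ω₂, lam, β, γ) = the pinned harmonic host (U =
ω₂q²/2, V = r²/2, Langevin baths γ at
both ends, i.e. pinnedChain ω₂ 0 0 γ) carrying the conjunct's own anharmonic unit — on-site lam·q⁴/4
at every site i with d ∣ i and the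
FPU-β term β·r⁴/4 on the following bond (i, i+1) — so that C_1 IS pinnedChain ω₂ lam β γ (support
SpacingOneDictionary) and C_d has harmonic
segments of d − 1 sites between consecutive cells. It suffices to show X = X_rung ∧ X_plug ∧ X_uniq:
 X_rung (crux DiluteFourierLaw): for all ω₂, lam, β, γ > 0 and every T > 0 there is d₀ = d₀(T) such
that for every spacing d ≥ d₀ the chain
 C_d obeys the Bonetto–Lebowitz–Rey-Bellet law AT TEMPERATURE T — ∃ κ_d(T) ∈ (0, ∞) such that for
every family of weak steady states
 D_N := lim_(δ→0, δ≠0) Σ_bonds μ_(N, T+δ/2, T−δ/2)(j_i)/δ exists for each N and D_N → κ_d(T) (clause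
(ii) of FouriersLawFor, pointwise in T,
 for C_d; non-vacuous by support DiluteNessExists);
 X_plug (crux SpacingClosure, the honest plug-in, NOT the card's mechanism): at each T, Fourier's
law for C_d at all large d implies it for C_1;
 X_uniq (support NessUnique = shared item stmt-AtomisticToContinuum-0741): weak steady states of
pinnedChain are unique.
ENGINE for X_rung (the card; cruxes GaussianisationCLT (rank 2), SingleCellMixing (3),
CellTransferGap (4) are filed informal right after
open together with their definition requests — they are the foreseen glued split of
DiluteFourierLaw): (1) ONE cell in the infinite harmonic
host at temperature T mixes with a rate; (2) LONG HARMONIC SEGMENTS GAUSSIANISE: the field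
re-emitted by a mixing cell, dispersed over a
segment of length d (group velocities vary over the band [√ω₂, √(ω₂+4)]), reaches the next cell
within ε_d → 0 of a stationary Gaussian
field with a frequency-resolved temperature profile T + δT(k); (3) the Gaussian-in/Gaussian-out
one-cell map 𝒦_T on profiles δT(k) is
positive and energy-conserving and INELASTIC scattering makes it irreducible — Perron–Frobenius:
simple eigenvalue 1 on the flat profile,
gap below — so M cells compose as 𝒦_T^M up to summable corrections: R_(Md) = M·r_d(T) + c_d(T) +
o(1), i.e. X_rung with κ_d = d/r_d,
and the per-cell resistance converges, r_d(T) → r(T) ∈ (0, ∞) (support PerCellResistanceLimit: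
Matthiessen additivity in the dilute limit,
the typed signature of the engine). CELL CHOICE (planner's correction of the card): an 'in-band
saturating impurity' does not exist in
one dimension — any net stiffness shift δ ≠ 0 at one site binds a Montroll–Potts defect mode outside
the band (Ω² = ω₂ + 2 + √(4 + δ²),
localisation rate asinh(δ/2); MontrollPotts1956, recomputed this session), and bounded designs keep
rotating-wave defect breathers above an
O(1/lam) energy threshold — so the route uses the conjunct's own cell, lands the ladder exactly on
the conjunct at d = 1, and confronts
breathers inside SingleCellMixing at fixed T > 0 (Arrhenius-small but positive rates), an item
shared in substance with card
dilute-nonlinearity-phonon-lorentz-gas (its CellMixing).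
Lean: `DiluteFourierLaw ∧ SpacingClosure ∧ NessUnique`

## Assembly
PROVED by the planner from the items as filed (folder AssemblyCheck.lean, rc 0, axioms propext /
Classical.choice / Quot.sound; to be copied
into Theorems by any prover): clause (i) of FouriersLawFor from the in-tree theorem
pinnedChain_exists_isSteadyState (CEHR 2018 Thm 2.13,
LangevinChainNESSHolds) + NessUnique; clause (ii): DiluteFourierLaw discharges the hypothesis of
SpacingClosure, giving for each T > 0 a
constant k_T > 0 and the pointwise law for C_1; κ(T) := k_T by Classical.choose (1 off (0, ∞));
SpacingOneDictionary moves every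
pinnedChain steady-state family into the C_1 class (Iff.mpr) and identifies the currents inside the
δ-limit (Tendsto.congr').
DiluteNessExists rides as the first antecedent (it de-vacuifies the rung; logically unused).

Rationale: WHY THIS LINE. Between cells everything is Gaussian and explicit (RiederLebowitzLieb1967,
CasherLebowitz1971; tree HarmonicChainCovariance/Flux), so the
only nonlinear objects are ONE cell in a Gaussian bath (return to equilibrium / radiation damping
technology: JaksicPillet1998, Konenberg2011,
EckmannPilletReyBellet1999a, KomechKomech2006, SofferWeinstein1999) and ONE positive linear operator
𝒦_T on L²(band) whose leading
inelastic kernel is the order-lam², β² Fermi-golden-rule kernel of the cell; independence between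
cells is a CLT for a mixing stationary
source filtered by a dispersive propagator (the Bernstein room–corridor scheme of
DudnikovaKomechSpohn2003 for harmonic crystals, dispersive
decay EgorovaKopylovaTeschl2015), and series addition is the Perron–Frobenius/Kreĭn–Rutman
contraction of 𝒦_T — the deterministic
derivation of what Büttiker probes and self-consistent reservoirs postulate (Buttiker1986,
BonettoLebowitzLukkarinen2004; exactly solved
stochastic twin: point Langevin thermostat scattering, KomorowskiOlla2020). Imported areas:
probability (CLTs for mixing sources, Gaussian
fields), spectral/scattering theory of discrete wave equations, positive-operator theory; no
physical analogy is load-bearing — the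
mesoscopic 'incoherent series resistor' picture (Dhar2008 §3) is derived, not assumed. What it does
that no other route does: the N → ∞
statement is manufactured by ITERATING an N-independent positive operator with a gap (M = N/d
iterations), with a GEOMETRIC small
parameter 1/d at O(1) deterministic anharmonicity — no infinite-volume current-correlation decay of
the interacting chain
(FourierGreenKubo), no comparison of three finite chains (FeketeResistance, SuperadditiveJunction),
no hydrodynamic closure
(LocalOhmRigidity), no added noise (NoiseHomotopyTransfer); and the ladder's d = 1 end is the
conjunct itself.

RANKED CRUXES. #5 DiluteFourierLaw (crux) — THE RUNG (card target DiluteFourier): for all ω₂, lam,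
β, γ > 0 and every T > 0 there is d₀ such that for every d ≥ d₀ the d-dilute conjunct chain C_d
(harmonic host pinnedChain ω₂ 0 0 γ plus lam·q_i⁴/4 at sites d ∣ i and β·(q_(i+1) − q_i)⁴/4 on bonds
(i, i+1) with d ∣ i; generator, weak steady states and bond currents written inline) satisfies
clause (ii) of FouriersLawFor at temperature T: ∃ k > 0 such that for EVERY family μ of weak steady
states (all N, T_L, T_R > 0) the response limits D_N = lim_(δ→0,δ≠0) (Σ_i ∫ j_i
dμ_(N,T+δ/2,T−δ/2))/δ exist and D_N → k. Parent of the foreseen split SingleCellMixing →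
GaussianisationCLT → CellTransferGap; claimable directly (other engine: the renewal/kinetic-window
argument of card dilute-nonlinearity-phonon-lorentz-gas, which however stops at M ≤ M(d)).
[difficulty: XL] (why it might fail: Cells may not mix at a rate (defect breathers above E* ~ c/lam
trap energy, Arrhenius-slow release); in 1-D re-emitted fields do not decay, so Gaussianisation
rests on temporal decorrelation alone (band-edge caustics); coherent inter-cell Fabry-Perot
correlations may survive thermal averaging.) [BonettoLebowitzReyBellet2000,
DudnikovaKomechSpohn2003, HairerMattingly2009, CasherLebowitz1971, Dhar2008, Konenberg2011]
#6 SpacingClosure (crux) — THE PLUG-IN (densification; not the card's mechanism, filed so that the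
assembly is honest and as the docking point for densification cards — two-channel-dephasing,
spatial-dynamics-slow-manifold, bath-renormalisation-parabolic-fixed-point): for all parameters > 0
and every T > 0, if C_d obeys the pointwise BLR law at T for all d ≥ some d₀, then C_1 (=
pinnedChain ω₂ lam β γ, by SpacingOneDictionary) obeys it at T. At d = 1 no harmonic segment is left
to Gaussianise: the dephaser must be the anharmonic neighbours themselves. [deps: DiluteFourierLaw]
[difficulty: open-problem] (why it might fail: It is the conjunct minus the rung: no
monotonicity/continuity of kappa_d in d is known; resistance comparison C_1 vs C_d
(Rayleigh/Matthiessen) fails for coherent transport (inelastic scatterers LOWER a localised host's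
resistance, DharLebowitz2008); d0(T) -> infinity as T -> 0.) [BonettoLebowitzReyBellet2000,
DharLebowitz2008, AokiLukkarinenSpohn2006, Dhar2008]
#9 PerCellResistanceLimit (support) — MATTHIESSEN ADDITIVITY IN THE DILUTE LIMIT (card CellIteration
output, the typed and numerically testable signature of the engine): for all parameters > 0 and T >
0 there is r = r(T) ∈ (0, ∞) — the resistance of ONE cell in the infinite harmonic host — such that
for every ε > 0 and all large d the chain C_d has a pointwise conductivity k = κ_d(T) > 0 (as in
DiluteFourierLaw) with |d/κ_d(T) − r(T)| < ε: resistances of far-apart deterministic cells add.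
[difficulty: XL] [Buttiker1986, BonettoLebowitzLukkarinen2004, Dhar2008, KomorowskiOlla2020]
#9 DiluteNessExists (support) — weak steady states of C_d exist for all d, N and T_L, T_R > 0
(de-vacuifies DiluteFourierLaw): Cuneo–Eckmann–Hairer–Rey-Bellet 2018 Thm 2.13 covers networks with
site-dependent polynomial potentials — harmonic sites have pinning degree 2 ≤ coupling degree 2,
cell sites 4 ≤ 4, V″ ≥ 1 everywhere, the path is controlled from its two ends; adapt the in-tree
proof CuneoEckmannHairerReyBellet2018_pinnedChain_holds (N = 0: point mass). [difficulty: L]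
[CuneoEckmannHairerReyBellet2018, Carmona2007, ReyBelletThomas2002]
#9 SpacingOneDictionary (support) — at d = 1 the inline dilute objects ARE the conjunct's: for every
N, T_L, T_R and μ, the inline weak-steady-state predicate of C_1 is equivalent to (pinnedChain ω₂
lam β γ).IsSteadyState N T_L T_R μ and the inline total current equals (pinnedChain ω₂ lam β
γ).totalCurrent μ (coordinate-line derivatives of the polynomial Hamiltonian; deriv V = r + βr³; `1
∣ i` is trivially true). [difficulty: provable-now] [BonettoLebowitzReyBellet2000]
#9 NessUnique (support) — shared item stmt-AtomisticToContinuum-0741 (FourierGreenKubo,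
FeketeResistance, LocalOhmRigidity, ScaleFreeQuarticAnchor): for pinnedChain ω₂ lam β γ (all > 0),
every N and T_L, T_R > 0, weak steady states (IsSteadyState) are unique. [difficulty: L]
[CuneoEckmannHairerReyBellet2018, EckmannPilletReyBellet1999a, ReyBelletThomas2002,
HairerMattingly2009]

TWO-LAYER PLAN. Foreseen glued split once the definition requests land and the three engine cruxes
carry signatures (k = 3, depth 1):
DiluteFourierLaw ⇐ SingleCellMixing → GaussianisationCLT → CellTransferGap → DiluteFourierLaw, with
glue = the card's CellIteration step
(M-cell NESS in linear response = M-fold iteration of the exact cell transfer, an ε_d-perturbation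
of 𝒦_T uniformly in M; gap stability);
PerCellResistanceLimit closes from the same three children. SingleCellMixing ⇐ RadiationDamping
(finite-energy: no embedded/defect
periodic orbit of the cell-in-host system survives, every rotating-wave breather has a radiating
channel or an escape route;
SofferWeinstein1999 / KomechKomech2006-type) → ThermalEscape (positive temperature: Arrhenius escape
from breather neighbourhoods gives an
L²(Gibbs) decay rate) → SingleCellMixing. SpacingClosure is NOT decomposed by this line.

KILL CRITERIA. (1) ¬DiluteFourierLaw — D_N(C_d) unbounded (ballistic-like) or → 0 for some large d
at some T, by proof or by certified numerics — closes
the route (close --reason refuted:DiluteFourierLaw) and says that sparse deterministic O(1)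
anharmonicity does not produce Ohm's law:
informative for every dephasing card. (2) Per-cell resistance d/κ_d(T) not converging — persistent
O(1) oscillations in d, i.e. coherent
inter-cell interference surviving thermal averaging — refutes PerCellResistanceLimit and the
Gaussianisation engine: pivot DiluteFourierLaw
to the sibling card's renewal engine (one --resplit) or close. (3) A positive-Gibbs-measure set of
non-radiating cell states (KAM tori /
breather neighbourhoods without escape) refutes SingleCellMixing: one restate with the softening
bounded cell (ω₂ ≤ 1/2, lam < 0: every
rotating-wave gap mode radiates through its third harmonic), then close. (4) SpacingClosure can only
die together with the conjunct
(rung true, FouriersLaw false): file ¬FouriersLaw. FouriersLaw proved elsewhere moots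
SpacingClosure; the rung items remain stand-alone
targets (first Fourier law with deterministic anharmonic scattering).

NOT DECOMPOSED YET. The engine's constants (cell mixing time τ(T); ε_d ≍ (τ/d)^(1/2); the FGR kernel
R_T(k, k′) at order lam², β² and its irreducibility
classes under the parity of the cell potential), the fixed-N linear-response step for C_d (existence
of D_N à la HairerMajda2009, the C_d
analogue of stmt-0717 — folded into DiluteFourierLaw, a child later), uniqueness of C_d's steady
states (not needed by the assembly), the
contact terms c_d(T), any uniformity in T (none claimed: d₀(T) → ∞ as T → 0, consistent with
LowTemperatureWeakAnharmonicity), and the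
whole interior d < d₀ of SpacingClosure (densification = the conjunct; other cards).

CHEAPEST FALSIFIER. (a) kit MD, not run (hub compute-free, one-shot unit): C_d with ω₂ = lam = β = γ
= 1, T = 1, d ∈ {4, 8, 16, 32}, N = M·d, M ∈ {2, …, 64}:
is R_N = (N − 1)/D_N affine in M, and does the slope r_d stabilise as d grows
(PerCellResistanceLimit)? sub-linear growth in M or
persistent oscillations of r_d in d kill the engine cheaply; (b) one cell in a long harmonic chain
(N = 2048, equal bath temperatures,
Gibbs start): does the cell-energy autocorrelation decay, and is there a plateau of weight ≈
e^(−E*/T) (breather trapping)? a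
non-decaying plateau kills SingleCellMixing; (c) lookup DONE this session: the Montroll–Potts defect
criterion (any δ ≠ 0 binds in 1-D,
Ω² = ω₂ + 2 + √(4 + δ²)) killed the card's in-band cell design before filing — hence the conjunct
cell.

NUMBERS. Phonon band of the host [√ω₂, √(ω₂ + 4)]; single-site stiffness defect δ: localised mode Ω²
= ω₂ + 2 + √(4 + δ²) > ω₂ + 4 for every δ > 0,
spatial rate asinh(δ/2) (MontrollPotts1956; recomputed here); harmonic host: flat bulk temperature
profile and size-independent flux
J_N → c(ω₂, γ)·δT (RiederLebowitzLieb1967; tree HarmonicChainFlux.fluxLimit), i.e. R_N(C_∞) = O(1);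
kinetic corner κ(T) ≍ (lam·T)^(−2)
(AokiLukkarinenSpohn2006) so r(T) = O(T²)-small and d₀(T) → ∞ as T → 0; expected staircase R_(Md) =
M·r_d + c_d with exponentially small
corrections in the gap of 𝒦_T. Items at open: 7 typed (2 crux, 4 support, 1 assembly) + 3 informal
cruxes = 10 ≤ 15.

DEFINITION REQUESTS. D1 SiteDependentOscillatorChain (Literature/MathematicalPhysics/KineticTheory):
chains with site-dependent U_i, V_i between Langevin baths —
hamiltonian / generator / bondCurrent / totalCurrent / IsSteadyState / FouriersLawFor mirroring
OscillatorChain, the embedding of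
OscillatorChain, and diluteChain ω₂ lam β γ d with the lemma that its generator and currents are the
inline terms used here (lets every
item be restated compactly; for DiluteFourierLaw). D2 HarmonicHostWithCell
(Summits/AtomisticToContinuum/FouriersLaw/Theorems): Hamiltonian
dynamics on ℤ of the pinned harmonic chain with ONE conjunct cell at the origin — tempered solutions
(LanfordLebowitzLieb1977-type; the
tree's InfiniteChainDynamics is homogeneous), its Gibbs measure at temperature T, time correlations
of local observables (for
SingleCellMixing, GaussianisationCLT). D3 cellTransferOperator 𝒦_T (same topic; INTERFACE: a
positive, energy-conserving bounded linear
map on L²(band) acting on incident spectral temperature perturbations; CONSTRUCTION statement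
separate: existence and uniqueness of the
stationary state of one cell driven by stationary Gaussian inputs, linear response in the profile;
for CellTransferGap). Cite facts
wanted: DudnikovaKomechSpohn2003 (space-mixing data ⇒ Gaussian limit for harmonic crystals),
Konenberg2011 / JaksicPillet1998 (return to
equilibrium of an anharmonic oscillator in a thermal field).

Novelty: Searches (2026-08-15; local searchd DOWN — ConnectionReset ×3 on `lit search`/`--hybrid`; openalex,
arXiv and S2 rate-limited after one
S2 query; galaxy panama queue timeout): `lit search --source zbmath` ×10 — "Dudnikova Komech Spohn
convergence equilibrium harmonic crystal"
(1: doi:10.1063/1.1571658), "Komech global attraction nonlinear oscillator Klein-Gordon" (4: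
doi:10.1007/s00205-006-0039-z,
doi:10.1016/j.crma.2006.06.009), "asymptotic stability breathers lattice Klein-Gordon" (5:
arXiv:nlin/0208014, arXiv:1509.06389,
arXiv:1111.1857, arXiv:2204.11349, arXiv:1905.11647), "Montroll Potts effect of defects on lattice
vibrations" (1: doi:10.1103/physrev.102.72),
"Soffer Weinstein resonances radiation damping" (2: doi:10.1007/s002220050303), "Egorova Kopylova
Teschl dispersion estimates discrete"
(1: doi:10.4171/jst/110), "self-consistent reservoirs Fourier law harmonic crystal" (2:
doi:10.1023/b:joss.0000037232.14365.10,
doi:10.1007/s10955-006-9235-3), "harmonic crystal nonlinear oscillator convergence to equilibrium"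
(0 relevant), "heat conduction chain
nonlinear impurity Langevin" (0), "Cuccagna asymptotic stability breathers" (0); `lit search
--source crossref "nonlinear impurity harmonic
chain heat conduction thermal resistance phonon scattering"` (12, none rigorous or on point); `lit
search --source s2 "heat conduction
harmonic chain with anharmonic impurities Fourier law"` (4: doi:10.1103/physrevlett.96.100601
Pereira–Falcão weak interparticle
anharmonicity, perturba  [refs: 10.1063/1.1571658, 10.1007/s00205-006-0039-z, 10.1016/j.crma.2006.06.009, 10.1103/physrev.102.72, 10.1007/s002220050303, 10.4171/jst/110, 10.1023/b:joss.0000037232.14365.10, 10.1007/s10955-006-9235-3, 10.1103/physrevlett.96.100601, 10.1088/0305-4470/39/30/002, 10.1007/s002201000581, 10.1023/b:joss.0000012516.89488.20, nlin/0208014, 1509.06389, 1111.1857, 2204.11349, 1905.11647, 2604.14056, 2508.15]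

Barriers (technique_class: dilute-scatterer-ladder gaussianisation-clt transfer-gap): - technique_class: dilute-scatterer-ladder gaussianisation-clt transfer-gap
- Literature.Barriers.AtomisticToContinuum.HarmonicChainBallisticFlux: USED, not fought — the host
is ballistic by design and C_d carries anharmonic cells at density 1/d, so
not_fouriersLawFor_harmonic does not apply; the rung's content is precisely that inelastic cells
turn the flat Rieder–Lebowitz–Lieb profile into an affine staircase.
- Literature.Barriers.AtomisticToContinuum.AjankiHuveneers2011_scaling: no elastic disorder — cells
are identical and periodic, so coherent elastic scattering alone would give Bloch bands (ballistic),
never localisation; the gap of 𝒦_T comes from the INELASTIC kernel only, and a reducible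
(frequency-diagonal) 𝒦 is the recorded failure mode of CellTransferGap.
- Literature.Barriers.AtomisticToContinuum.HairerMattingly2009_threeOscillators: APPLIES at each
cell (quartic pinning facing a harmonic bond on one side): slow release of energy from high-energy
cell states; the bet is that at fixed T > 0 this renormalises the mixing RATE by an Arrhenius factor
e^(−E*/T) (E* ≈ c/lam, the defect-breather threshold) without destroying mixing — recorded as
SingleCellMixing's why-fail and kill criterion (3).
- Literature.Barriers.AtomisticToContinuum.HasBoundedResponse: for C_d, boundedness of D_N is
manufactured by M = N/d iterations of an N-INDEPENDENT contraction, not by an N-uniform estimate on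
one chain; for the conjunct (d = 1) the barrier sits untouched inside SpacingClosure

History (route lifecycle, newest last):
- 2026-08-15T13:42:45Z · CLOSED retired — not-a-thesis: assembly does not conclude the sub-problem Statement (operator:999:1257524)

sub-problem: FouriersLaw · status: closed(retired) · opened planner-plancard-AtomisticToContinuum-Fourier-4be09a07-0 2026-08-15T11:31:07Z · rev 1 · ledger route-AtomisticToContinuum-GaussianiserCellTransfer
GENERATED by the gate from the ledger (D-0016/17). Provers cite these decls: `theorem foo : Summit.AtomisticToContinuum.FouriersLaw.Theses.GaussianiserCellTransfer.<Decl> := …` in Summits/AtomisticToContinuum/FouriersLaw/Theorems/<Name>.lean.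
-/

namespace Summit.AtomisticToContinuum.FouriersLaw.Theses.GaussianiserCellTransfer

open scoped BigOperators Topology Manifold Classical MeasureTheory ProbabilityTheory Matrix InnerProductSpace ComplexConjugate ContinuousMap
open Filter Set Function TopologicalSpace MeasureTheory

attribute [summit_statement] _root_.FouriersLaw

-- item stmt-AtomisticToContinuum-5129 · crux · rank 2 · closed · moot by None · by planner — informal only, no Lean statement yet:
--   [crux] GAUSSIANISATION CLT (card crux 2, the engine's hardest step; needs definition requests D2
--   HarmonicHostWithCell and D1): in the infinite pinned harmonic host (pinning ω₂ > 0, unit harmonic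
--   bonds) at temperature T carrying TWO conjunct cells (lam q⁴/4 on-site + β r⁴/4 on the following
--   bond) at distance d, in the stationary (Gibbs) regime and in linear response, the joint law of (the
--   left-incoming field at cell 2 restricted to a time window of length τ, the state of cell 2) is
--   within ε_d of 'an independent stationary GAUSSIAN field with the correct spectral covariance
--   (frequency-resolved t

-- item stmt-AtomisticToContinuum-5550 · crux · rank 3 · closed · moot by None · by planner — informal only, no Lean statement yet:
--   [crux] SINGLE-CELL MIXING (card crux 1 = CellMixing of card dilute-nonlinearity-phonon-lorentz-gas,
--   one shared item in substance; needs definition request D2 HarmonicHostWithCell): for the infinite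
--   pinned harmonic chain on ℤ (pinning ω₂ > 0, unit harmonic bonds) carrying ONE conjunct cell at the
--   origin (on-site lam q₀⁴/4 and FPU-β term β (q₁ − q₀)⁴/4, lam, β > 0), with Gibbs data at temperature
--   T > 0 (an invariant probability measure of the infinite dynamics): time correlations of local
--   observables near the cell decay to zero, quantitatively with an integrable rate — ∫₀^∞ |⟨F ;
--   G∘Φ_t⟩_T| dt <

-- item stmt-AtomisticToContinuum-5557 · crux · rank 4 · closed · moot by None · by planner — informal only, no Lean statement yet:
--   [crux] CELL TRANSFER GAP + ITERATION (card cruxes 3–4; needs definition request D3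
--   cellTransferOperator, and D1): (a) ONE-CELL GAP: for one conjunct cell in the infinite harmonic host
--   at temperature T, the Gaussian-input/Gaussian-output linear-response map 𝒦_T on incident spectral
--   temperature perturbations δT(k) ∈ L²(band) — (elastic, frequency-diagonal part) + (inelastic
--   redistribution kernel R_T(k, k′) ≥ 0) — is a positive, energy-conserving operator with SIMPLE
--   eigenvalue 1 on the flat profile and ‖𝒦_T restricted to flat^⊥‖ < 1; the inelastic kernel is
--   irreducible on the band (explicit at o

/-- item stmt-AtomisticToContinuum-4265 · crux · rank 5 · closed · moot by None · by planner
why it might fail: Cells may not mix at a rate (defect breathers above E* ~ c/lam trap energy, Arrhenius-slow release); in 1-D re-emitted fields do not decay, so Gaussianisation rests on temporal decorrelation alone (band-edge caustics); coherent inter-cell Fabry-Perot correlations may survive thermal averaging.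
sources: BonettoLebowitzReyBellet2000, DudnikovaKomechSpohn2003, HairerMattingly2009, CasherLebowitz1971, Dhar2008, Konenberg2011
[crux] THE RUNG (card target DiluteFourier): for all ω₂, lam, β, γ > 0 and every T > 0 there is d₀
such that for every d ≥ d₀ the d-dilute conjunct chain C_d (harmonic host pinnedChain ω₂ 0 0 γ plus
lam·q_i⁴/4 at sites d ∣ i and β·(q_(i+1) − q_i)⁴/4 on bonds (i, i+1) with d ∣ i; generator, weak
steady states and bond currents written inline) satisfies clause (ii) of FouriersLawFor at
temperature T: ∃ k > 0 such that for EVERY family μ of weak steady states (all N, T_L, T_R > 0) the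
response limits D_N = lim_(δ→0,δ≠0) (Σ_i ∫ j_i dμ_(N,T+δ/2,T−δ/2))/δ exist and D_N → k. Parent of
the foreseen split SingleCellMixing → GaussianisationCLT → CellTransferGap; claimable directly
(other engine: the renewal/kinetic-window argument of card dilute-nonlinearity-phonon-lorentz-gas,
which however stops at M ≤ M(d)). [difficulty: XL] -/
@[route_item "route-AtomisticToContinuum-GaussianiserCellTransfer"]
def DiluteFourierLaw : Prop :=
  ∀ ω₂ lam β γ : ℝ, 0 < ω₂ → 0 < lam → 0 < β → 0 < γ → ∀ T : ℝ, 0 < T → ∃ d₀ : ℕ, ∀ d : ℕ, d₀ ≤ d → ∃ k : ℝ, 0 < k ∧ ∀ μ : (N : ℕ) → ℝ → ℝ → MeasureTheory.Measure (Literature.MathematicalPhysics.KineticTheory.HeatConduction.PhaseSpace N), (∀ (N : ℕ) (T_L T_R : ℝ), 0 < T_L → 0 < T_R → (MeasureTheory.IsProbabilityMeasure (μ N T_L T_R) ∧ (∀ f : Literature.MathematicalPhysics.KineticTheory.HeatConduction.PhaseSpace N → ℝ, ContDiff ℝ ((⊤ : ℕ∞) : WithTop ℕ∞) f → HasCompactSupport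 f → ∫ x, ((Literature.MathematicalPhysics.KineticTheory.HeatConduction.pinnedChain ω₂ 0 0 γ).generator N T_L T_R f x + ∑ i : Fin N, ((if d ∣ i.val then -(lam * x.1 i ^ 3 * Literature.MathematicalPhysics.KineticTheory.HeatConduction.partialP i f x) else 0) + ∑ j : Fin N, (if j.val = i.val + 1 ∧ d ∣ i.val then β * (x.1 j - x.1 i) ^ 3 * (Literature.MathematicalPhysics.KineticTheory.HeatConduction.partialP i f x - Literature.MathematicalPhysics.KineticTheory.HeatConduction.partialP j f x) else 0))) ∂(μ N T_L T_R) = 0) ∧ ∀ i : Fin N, MeasureTheory.Integrable (fun x : Literature.MathematicalPhysics.KineticTheory.HeatConduction.PhaseSpace N => ∑ j : Fin N, (if j.val = i.val + 1 then -((x.2 i + x.2 j) / 2 * ((x.1 j - x.1 i) + (if d ∣ i.val then β * (x.1 j - x.1 i) ^ 3 else 0))) else 0)) (μ N T_L T_R))) → ∃ D : ℕ → ℝ, (∀ N : ℕ, Filter.Tendsto (fun δ : ℝ => (∑ i : Fin N, ∫ x, (∑ j : Fin N, (if j.val = i.val + 1 then -((x.2 i + x.2 j) / 2 * ((x.1 j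 - x.1 i) + (if d ∣ i.val then β * (x.1 j - x.1 i) ^ 3 else 0))) else 0)) ∂(μ N (T + δ / 2) (T - δ / 2))) / δ) (nhdsWithin 0 {(0 : ℝ)}ᶜ) (nhds (D N))) ∧ Filter.Tendsto D Filter.atTop (nhds k)

/-- item stmt-AtomisticToContinuum-4266 · crux · rank 6 · closed · moot by None · by planner
why it might fail: It is the conjunct minus the rung: no monotonicity/continuity of kappa_d in d is known; resistance comparison C_1 vs C_d (Rayleigh/Matthiessen) fails for coherent transport (inelastic scatterers LOWER a localised host's resistance, DharLebowitz2008); d0(T) -> infinity as T -> 0.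
sources: BonettoLebowitzReyBellet2000, DharLebowitz2008, AokiLukkarinenSpohn2006, Dhar2008
[crux] THE PLUG-IN (densification; not the card's mechanism, filed so that the assembly is honest
and as the docking point for densification cards — two-channel-dephasing,
spatial-dynamics-slow-manifold, bath-renormalisation-parabolic-fixed-point): for all parameters > 0
and every T > 0, if C_d obeys the pointwise BLR law at T for all d ≥ some d₀, then C_1 (=
pinnedChain ω₂ lam β γ, by SpacingOneDictionary) obeys it at T. At d = 1 no harmonic segment is left
to Gaussianise: the dephaser must be the anharmonic neighbours themselves. [deps: DiluteFourierLaw]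
[difficulty: open-problem] -/
@[route_item "route-AtomisticToContinuum-GaussianiserCellTransfer"]
def SpacingClosure : Prop :=
  ∀ ω₂ lam β γ : ℝ, 0 < ω₂ → 0 < lam → 0 < β → 0 < γ → ∀ T : ℝ, 0 < T → (∃ d₀ : ℕ, ∀ d : ℕ, d₀ ≤ d → ∃ k : ℝ, 0 < k ∧ ∀ μ : (N : ℕ) → ℝ → ℝ → MeasureTheory.Measure (Literature.MathematicalPhysics.KineticTheory.HeatConduction.PhaseSpace N), (∀ (N : ℕ) (T_L T_R : ℝ), 0 < T_L → 0 < T_R → (MeasureTheory.IsProbabilityMeasure (μ N T_L T_R) ∧ (∀ f : Literature.MathematicalPhysics.KineticTheory.HeatConduction.PhaseSpace N → ℝ, ContDiff ℝ ((⊤ : ℕ∞) : WithTop ℕ∞) f → HasCompactSupport f → ∫ x, ((Literature.MathematicalPhysics.KineticTheory.HeatConduction.pinnedChain ω₂ 0 0 γ).generator N T_L T_R f x + ∑ i : Fin N, ((if d ∣ i.val then -(lam * x.1 i ^ 3 * Literature.MathematicalPhysics.KineticTheory.HeatConduction.partialP i f x) else 0) + ∑ j : Fin N, (if j.val = i.val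 + 1 ∧ d ∣ i.val then β * (x.1 j - x.1 i) ^ 3 * (Literature.MathematicalPhysics.KineticTheory.HeatConduction.partialP i f x - Literature.MathematicalPhysics.KineticTheory.HeatConduction.partialP j f x) else 0))) ∂(μ N T_L T_R) = 0) ∧ ∀ i : Fin N, MeasureTheory.Integrable (fun x : Literature.MathematicalPhysics.KineticTheory.HeatConduction.PhaseSpace N => ∑ j : Fin N, (if j.val = i.val + 1 then -((x.2 i + x.2 j) / 2 * ((x.1 j - x.1 i) + (if d ∣ i.val then β * (x.1 j - x.1 i) ^ 3 else 0))) else 0)) (μ N T_L T_R))) → ∃ D : ℕ → ℝ, (∀ N : ℕ, Filter.Tendsto (fun δ : ℝ => (∑ i : Fin N, ∫ x, (∑ j : Fin N, (if j.val = i.val + 1 then -((x.2 i + x.2 j) / 2 * ((x.1 j - x.1 i) + (if d ∣ i.val then β * (x.1 j - x.1 i) ^ 3 else 0))) else 0)) ∂(μ N (T + δ / 2) (T - δ / 2))) / δ) (nhdsWithin 0 {(0 : ℝ)}ᶜ) (nhds (D N))) ∧ Filter.Tendsto D Filter.atTop (nhds k)) → ∃ k : ℝ, 0 < k ∧ ∀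 μ : (N : ℕ) → ℝ → ℝ → MeasureTheory.Measure (Literature.MathematicalPhysics.KineticTheory.HeatConduction.PhaseSpace N), (∀ (N : ℕ) (T_L T_R : ℝ), 0 < T_L → 0 < T_R → (MeasureTheory.IsProbabilityMeasure (μ N T_L T_R) ∧ (∀ f : Literature.MathematicalPhysics.KineticTheory.HeatConduction.PhaseSpace N → ℝ, ContDiff ℝ ((⊤ : ℕ∞) : WithTop ℕ∞) f → HasCompactSupport f → ∫ x, ((Literature.MathematicalPhysics.KineticTheory.HeatConduction.pinnedChain ω₂ 0 0 γ).generator N T_L T_R f x + ∑ i : Fin N, ((if 1 ∣ i.val then -(lam * x.1 i ^ 3 * Literature.MathematicalPhysics.KineticTheory.HeatConduction.partialP i f x) else 0) + ∑ j : Fin N, (if j.val = i.val + 1 ∧ 1 ∣ i.val then β * (x.1 j - x.1 i) ^ 3 * (Literature.MathematicalPhysics.KineticTheory.HeatConduction.partialP i f x - Literature.MathematicalPhysics.KineticTheory.HeatConduction.partialP j f x) else 0))) ∂(μ N T_L T_R) = 0) ∧ ∀ i : Fin N, MeasureTheory.Integrable (fun x : Literature.MathematicalPhysics.KineticTheory.HeatConduction.PhaseSpace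 N => ∑ j : Fin N, (if j.val = i.val + 1 then -((x.2 i + x.2 j) / 2 * ((x.1 j - x.1 i) + (if 1 ∣ i.val then β * (x.1 j - x.1 i) ^ 3 else 0))) else 0)) (μ N T_L T_R))) → ∃ D : ℕ → ℝ, (∀ N : ℕ, Filter.Tendsto (fun δ : ℝ => (∑ i : Fin N, ∫ x, (∑ j : Fin N, (if j.val = i.val + 1 then -((x.2 i + x.2 j) / 2 * ((x.1 j - x.1 i) + (if 1 ∣ i.val then β * (x.1 j - x.1 i) ^ 3 else 0))) else 0)) ∂(μ N (T + δ / 2) (T - δ / 2))) / δ) (nhdsWithin 0 {(0 : ℝ)}ᶜ) (nhds (D N))) ∧ Filter.Tendsto D Filter.atTop (nhds k)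

/-- item stmt-AtomisticToContinuum-0741 · support · rank 9 · closed · proved by Summit.AtomisticToContinuum.FouriersLaw.Theorems.nessUnique_proof (prover) · by planner
[crux] UNIQUENESS OF THE WEAK STEADY STATE (the half of stmt-0706 not covered by the landed fact
Literature.MathematicalPhysics.KineticTheory.HeatConduction.CuneoEckmannHairerReyBellet2018_pinnedChain,
p3544): for pinnedChain ω₂ lam β γ (all > 0), every N and T_L, T_R > 0, any two measures in the weak
Fokker–Planck class IsSteadyState (probability, ∫ L f dμ = 0 for f ∈ C_c^∞, bond currents
integrable) coincide. Print: uniqueness of the INVARIANT MEASURE of the Langevin semigroup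
(CuneoEckmannHairerReyBellet2018 Thm 2.13(1): C1, C2, CA; Carmona2007 Thm 1.1(iii)); the item
additionally needs 'weak stationary probability solution of L*μ = 0 ⇒ P_t-invariant' for this
hypoelliptic L with cubic drift (Echeverría 1982 well-posed martingale problem on C_c^∞ +
non-explosion via e^{θH}; Bogachev–Krylov–Röckner–Shaposhnikov 2015 Ch. 5 is non-degenerate only) —
the FP-identification lemma is the formal crux. N = 0: PhaseSpace 0 is a point (unique probability
measure); N = 1: both baths on site 0, OU at temperature (T_L+T_R)/2. This is exactly the hypothesis
of FiniteResponse and ThermodynamicLimit and, with the fact, gives clause (i) of FouriersLawFor. -/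
@[route_item "route-AtomisticToContinuum-GaussianiserCellTransfer"]
def NessUnique : Prop :=
  ∀ ω₂ lam β γ : ℝ, 0 < ω₂ → 0 < lam → 0 < β → 0 < γ → ∀ (N : ℕ) (T_L T_R : ℝ), 0 < T_L → 0 < T_R → ∀ μ ν : MeasureTheory.Measure (Literature.MathematicalPhysics.KineticTheory.HeatConduction.PhaseSpace N), (Literature.MathematicalPhysics.KineticTheory.HeatConduction.pinnedChain ω₂ lam β γ).IsSteadyState N T_L T_R μ → (Literature.MathematicalPhysics.KineticTheory.HeatConduction.pinnedChain ω₂ lam β γ).IsSteadyState N T_L T_R ν → μ = ν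

/-- item stmt-AtomisticToContinuum-4267 · support · rank 9 · closed · moot by None · by planner
sources: Buttiker1986, BonettoLebowitzLukkarinen2004, Dhar2008, KomorowskiOlla2020
[support] MATTHIESSEN ADDITIVITY IN THE DILUTE LIMIT (card CellIteration output, the typed and
numerically testable signature of the engine): for all parameters > 0 and T > 0 there is r = r(T) ∈
(0, ∞) — the resistance of ONE cell in the infinite harmonic host — such that for every ε > 0 and
all large d the chain C_d has a pointwise conductivity k = κ_d(T) > 0 (as in DiluteFourierLaw) with
|d/κ_d(T) − r(T)| < ε: resistances of far-apart deterministic cells add. [difficulty: XL] -/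
@[route_item "route-AtomisticToContinuum-GaussianiserCellTransfer"]
def PerCellResistanceLimit : Prop :=
  ∀ ω₂ lam β γ : ℝ, 0 < ω₂ → 0 < lam → 0 < β → 0 < γ → ∀ T : ℝ, 0 < T → ∃ r : ℝ, 0 < r ∧ ∀ ε : ℝ, 0 < ε → ∃ d₀ : ℕ, ∀ d : ℕ, d₀ ≤ d → ∃ k : ℝ, 0 < k ∧ (∀ μ : (N : ℕ) → ℝ → ℝ → MeasureTheory.Measure (Literature.MathematicalPhysics.KineticTheory.HeatConduction.PhaseSpace N), (∀ (N : ℕ) (T_L T_R : ℝ), 0 < T_L → 0 < T_R → (MeasureTheory.IsProbabilityMeasure (μ N T_L T_R) ∧ (∀ f : Literature.MathematicalPhysics.KineticTheory.HeatConduction.PhaseSpace N → ℝ, ContDiff ℝ ((⊤ : ℕ∞) : WithTop ℕ∞) f → HasCompactSupport f → ∫ x, ((Literature.MathematicalPhysics.KineticTheory.HeatConduction.pinnedChain ω₂ 0 0 γ).generator N T_L T_R f x + ∑ i : Fin N, ((if d ∣ i.val then -(lam * x.1 i ^ 3 * Literature.MathematicalPhysics.KineticTheory.HeatConduction.partialP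 i f x) else 0) + ∑ j : Fin N, (if j.val = i.val + 1 ∧ d ∣ i.val then β * (x.1 j - x.1 i) ^ 3 * (Literature.MathematicalPhysics.KineticTheory.HeatConduction.partialP i f x - Literature.MathematicalPhysics.KineticTheory.HeatConduction.partialP j f x) else 0))) ∂(μ N T_L T_R) = 0) ∧ ∀ i : Fin N, MeasureTheory.Integrable (fun x : Literature.MathematicalPhysics.KineticTheory.HeatConduction.PhaseSpace N => ∑ j : Fin N, (if j.val = i.val + 1 then -((x.2 i + x.2 j) / 2 * ((x.1 j - x.1 i) + (if d ∣ i.val then β * (x.1 j - x.1 i) ^ 3 else 0))) else 0)) (μ N T_L T_R))) → ∃ D : ℕ → ℝ, (∀ N : ℕ, Filter.Tendsto (fun δ : ℝ => (∑ i : Fin N, ∫ x, (∑ j : Fin N, (if j.val = i.val + 1 then -((x.2 i + x.2 j) / 2 * ((x.1 j - x.1 i) + (if d ∣ i.val then β * (x.1 j - x.1 i) ^ 3 else 0))) else 0)) ∂(μ N (T + δ / 2) (T - δ / 2))) / δ) (nhdsWithin 0 {(0 : ℝ)}ᶜ) (nhds (D N))) ∧ Filter.Tendsto D Filter.atTop (nhds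 k)) ∧ |(d : ℝ) / k - r| < ε

/-- item stmt-AtomisticToContinuum-4268 · support · rank 9 · closed · moot by None · by planner
sources: CuneoEckmannHairerReyBellet2018, Carmona2007, ReyBelletThomas2002
[support] weak steady states of C_d exist for all d, N and T_L, T_R > 0 (de-vacuifies
DiluteFourierLaw): Cuneo–Eckmann–Hairer–Rey-Bellet 2018 Thm 2.13 covers networks with site-dependent
polynomial potentials — harmonic sites have pinning degree 2 ≤ coupling degree 2, cell sites 4 ≤ 4,
V″ ≥ 1 everywhere, the path is controlled from its two ends; adapt the in-tree proof
CuneoEckmannHairerReyBellet2018_pinnedChain_holds (N = 0: point mass). [difficulty: L] -/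
@[route_item "route-AtomisticToContinuum-GaussianiserCellTransfer"]
def DiluteNessExists : Prop :=
  ∀ ω₂ lam β γ : ℝ, 0 < ω₂ → 0 < lam → 0 < β → 0 < γ → ∀ (d N : ℕ) (T_L T_R : ℝ), 0 < T_L → 0 < T_R → ∃ μ : MeasureTheory.Measure (Literature.MathematicalPhysics.KineticTheory.HeatConduction.PhaseSpace N), (MeasureTheory.IsProbabilityMeasure (μ) ∧ (∀ f : Literature.MathematicalPhysics.KineticTheory.HeatConduction.PhaseSpace N → ℝ, ContDiff ℝ ((⊤ : ℕ∞) : WithTop ℕ∞) f → HasCompactSupport f → ∫ x, ((Literature.MathematicalPhysics.KineticTheory.HeatConduction.pinnedChain ω₂ 0 0 γ).generator N T_L T_R f x + ∑ i : Fin N, ((if d ∣ i.val then -(lam * x.1 i ^ 3 * Literature.MathematicalPhysics.KineticTheory.HeatConduction.partialP i f x) else 0) + ∑ j : Fin N, (if j.val = i.val + 1 ∧ d ∣ i.val then β * (x.1 j - x.1 i) ^ 3 * (Literature.MathematicalPhysics.KineticTheory.HeatConduction.partialP i f x - Literature.MathematicalPhysics.KineticTheory.HeatConduction.partialP j f x)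 else 0))) ∂(μ) = 0) ∧ ∀ i : Fin N, MeasureTheory.Integrable (fun x : Literature.MathematicalPhysics.KineticTheory.HeatConduction.PhaseSpace N => ∑ j : Fin N, (if j.val = i.val + 1 then -((x.2 i + x.2 j) / 2 * ((x.1 j - x.1 i) + (if d ∣ i.val then β * (x.1 j - x.1 i) ^ 3 else 0))) else 0)) (μ))

/-- item stmt-AtomisticToContinuum-4269 · support · rank 9 · closed · moot by None · by planner
sources: BonettoLebowitzReyBellet2000
[support] at d = 1 the inline dilute objects ARE the conjunct's: for every N, T_L, T_R and μ, the
inline weak-steady-state predicate of C_1 is equivalent to (pinnedChain ω₂ lam β γ).IsSteadyState N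
T_L T_R μ and the inline total current equals (pinnedChain ω₂ lam β γ).totalCurrent μ
(coordinate-line derivatives of the polynomial Hamiltonian; deriv V = r + βr³; `1 ∣ i` is trivially
true). [difficulty: provable-now] -/
@[route_item "route-AtomisticToContinuum-GaussianiserCellTransfer"]
def SpacingOneDictionary : Prop :=
  ∀ ω₂ lam β γ : ℝ, 0 < ω₂ → 0 < lam → 0 < β → 0 < γ → ∀ (N : ℕ) (T_L T_R : ℝ) (μ : MeasureTheory.Measure (Literature.MathematicalPhysics.KineticTheory.HeatConduction.PhaseSpace N)), (((MeasureTheory.IsProbabilityMeasure (μ) ∧ (∀ f : Literature.MathematicalPhysics.KineticTheory.HeatConduction.PhaseSpace N → ℝ, ContDiff ℝ ((⊤ : ℕ∞) : WithTop ℕ∞) f → HasCompactSupport f → ∫ x, ((Literature.MathematicalPhysics.KineticTheory.HeatConduction.pinnedChain ω₂ 0 0 γ).generator N T_L T_R f x + ∑ i : Fin N, ((if 1 ∣ i.val then -(lam * x.1 i ^ 3 * Literature.MathematicalPhysics.KineticTheory.HeatConduction.partialP i f x) else 0) + ∑ j : Fin N, (if j.val = i.val + 1 ∧ 1 ∣ i.val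 then β * (x.1 j - x.1 i) ^ 3 * (Literature.MathematicalPhysics.KineticTheory.HeatConduction.partialP i f x - Literature.MathematicalPhysics.KineticTheory.HeatConduction.partialP j f x) else 0))) ∂(μ) = 0) ∧ ∀ i : Fin N, MeasureTheory.Integrable (fun x : Literature.MathematicalPhysics.KineticTheory.HeatConduction.PhaseSpace N => ∑ j : Fin N, (if j.val = i.val + 1 then -((x.2 i + x.2 j) / 2 * ((x.1 j - x.1 i) + (if 1 ∣ i.val then β * (x.1 j - x.1 i) ^ 3 else 0))) else 0)) (μ))) ↔ (Literature.MathematicalPhysics.KineticTheory.HeatConduction.pinnedChain ω₂ lam β γ).IsSteadyState N T_L T_R μ) ∧ (∑ i : Fin N, ∫ x, (∑ j : Fin N, (if j.val = i.val + 1 then -((x.2 i + x.2 j) / 2 * ((x.1 j - x.1 i) + (if 1 ∣ i.val then β * (x.1 j - x.1 i) ^ 3 else 0))) else 0)) ∂(μ)) = (Literature.MathematicalPhysics.KineticTheory.HeatConduction.pinnedChain ω₂ lam β γ).totalCurrent μ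

-- TODO item stmt-AtomisticToContinuum-4270 · assembly · rank 1 · closed · moot by None · by planner — BLOCKED: missing decl(s) NessUnique; restate via `ledger route edit` once they land:
--   def Assembly : Prop := DiluteNessExists → DiluteFourierLaw → SpacingClosure → SpacingOneDictionary → NessUnique → Literature.MathematicalPhysics.KineticTheory.HeatConduction.FouriersLaw

end Summit.AtomisticToContinuum.FouriersLaw.Theses.GaussianiserCellTransfer
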